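import Summits.Schanuel.Schanuel.Theses.DiophantineDichotomy
import Literature.NumberTheory.Transcendental.PhilipponCriterionProofs

/-!
# The output-independent ("scale") exponent is false at Liouville numbers
(negative lemma for crux `stmt-Schanuel-6117`, `ApproximationProperty`, route DiophantineDichotomy)

The crux `Summit.Schanuel.Schanuel.Theses.DiophantineDichotomy.ApproximationProperty` demands, at
scale `(Δ, Y)`, an algebraic approximation `γ` of certified degree `d ≤ (cΔ)ᵗ` and naive height
`log H ≤ cYΔ^{t-1}` with accuracy `exp(−(log H·Δ + d·Y)/c)` — an exponent in the OUTPUT `(d, H)`.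
Laurent–Roy (Ann. Inst. Fourier 49 (1999) 27–55, doi:10.5802/aif.1668), pp. 27–28, after stating
the all-scales output-dependent property on a curve ("pour tout choix de paramètres réels d et t
avec t ≥ d ≥ 1, il existe un point algébrique α ∈ C(ℚ̄) de degré d(α) ≤ d et de taille t(α) ≤ t
dont la distance à θ … soit ≤ exp(−c(dt(α) + td(α)))"), remark: "Par contre, l'énoncé ci-dessus
est faux si on exige que la distance de α à θ soit ≤ exp(−cdt). On s'en convainc facilement dans
le cas m = 1 en prenant pour θ un nombre transcendant arbitrairement voisin de 1 et en appliquant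
l'inégalité de Liouville." Their `c` depends only on the curve; the crux's constant is POINTWISE
(`c = c(θ)`), and against a pointwise constant the easy argument needs near-rationality of `θ` at
infinitely many scales — a Liouville number. We kernel-check exactly that, for the `t = 1` slice
(`ApproximationPropertyDegOne`, stmt-Schanuel-11037, which the crux contains verbatim):

* `repulsion` — Liouville repulsion near a rational point WITHOUT coprimality: if `γ ≠ a/b` is a
  root of a non-zero `P ∈ ℤ[X]` of degree `≤ d` and height `≤ H`, `|a/b| ≤ A`, `1 ≤ A`,
  `‖γ − a/b‖ ≤ 1`, then `1 ≤ b^d · d·((d+1)·4^d·H·A^d) · ‖γ − a/b‖` (Taylor expansion at `a/b`: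
  the trailing Hasse-derivative value is a non-zero rational with denominator `b^d`).
* `scaleExponent_false_at_liouville` — for EVERY Liouville `ξ` and EVERY `c ≥ 1` the scale form
  fails at `θ = (ξ) ∈ ℂ¹`; `scaleExponent_false` — hence the scale form of
  `ApproximationPropertyDegOne` is false (witness `Σ 2^{-k!}`).

So any proof of the crux must use the output `(d, H)` in the exponent; conversely the crux's
output-dependent form is exactly what survives (Diaz 1997 = Bugeaud 2004 Thm 8.11 proves it for
single numbers). Everything is proved; no definitions, no named facts.
-/

noncomputable section

-- `Summit.Schanuel.Schanuel.…` is the mandated summit/sub-problem namespace (single-conjunct summit):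
set_option linter.dupNamespace false

namespace Summit.Schanuel.Schanuel.Theorems.ApproximationPropertyScaleExponentLiouville

open Polynomial

/-- `hasseDeriv` commutes with `Polynomial.map`. -/
theorem hasseDeriv_map {R S : Type*} [Semiring R] [Semiring S] (f : R →+* S) (n : ℕ)
    (p : R[X]) : hasseDeriv n (p.map f) = (hasseDeriv n p).map f := by
  ext k
  simp [hasseDeriv_coeff, coeff_map]

/-- Coefficient bound for Hasse derivatives of a polynomial of height `≤ H`. -/
theorem abs_coeff_hasseDeriv_le {P : ℤ[X]} {H : ℕ} (hco : ∀ k, |P.coeff k| ≤ (H : ℤ))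
    (n k : ℕ) : |(hasseDeriv n P).coeff k| ≤ 2 ^ (k + n) * (H : ℤ) := by
  rw [hasseDeriv_coeff, abs_mul]
  have h1 : |(((k + n).choose n : ℕ) : ℤ)| ≤ 2 ^ (k + n) := by
    rw [abs_of_nonneg (by positivity)]
    exact_mod_cast Nat.choose_le_two_pow (k + n) n
  exact mul_le_mul h1 (hco _) (abs_nonneg _) (by positivity)

/-- The `n`-th Taylor coefficient of `P` at `a/b` (over `ℂ`) is the cast of the rational value of the
`n`-th Hasse derivative of `P` at `a/b`. -/
theorem taylor_coeff_eq_ratCast (P : ℤ[X]) (a b : ℤ) (n : ℕ) :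
    (taylor ((a : ℂ) / b) (P.map (Int.castRingHom ℂ))).coeff n = (((eval ((a : ℚ) / b) ((hasseDeriv n P).map (algebraMap ℤ ℚ))) : ℚ) : ℂ) := by
  rw [taylor_coeff, hasseDeriv_map, eval_map, eval_map]
  have h := (hasseDeriv n P).hom_eval₂ (algebraMap ℤ ℚ) (Rat.castHom ℂ) ((a : ℚ) / b)
  have hcomp : (Rat.castHom ℂ).comp (algebraMap ℤ ℚ) = Int.castRingHom ℂ := RingHom.ext_int _ _
  rw [hcomp, map_div₀, map_intCast, map_intCast, Rat.coe_castHom] at h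
  exact h.symm

/-- Integrality: a non-zero Taylor coefficient at `a/b` is at least `b^{-d}` in size. -/
theorem tq_lower {P : ℤ[X]} {a b : ℤ} (hb : 0 < b) {d : ℕ} (hdeg : P.natDegree ≤ d) {n : ℕ}
    (hn : (eval ((a : ℚ) / b) ((hasseDeriv n P).map (algebraMap ℤ ℚ))) ≠ 0) :
    1 ≤ (b : ℚ) ^ d * |(eval ((a : ℚ) / b) ((hasseDeriv n P).map (algebraMap ℤ ℚ)))| := by
  have h := one_le_pow_mul_abs_eval_div (K := ℚ) (f := hasseDeriv n P) (a := a) hb hn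
  refine h.trans (mul_le_mul_of_nonneg_right ?_ (abs_nonneg _))
  have hb1 : (1 : ℚ) ≤ b := by exact_mod_cast hb
  exact pow_le_pow_right₀ hb1 ((natDegree_hasseDeriv_le P n).trans ((Nat.sub_le _ _).trans hdeg))

/-- Size: every Taylor coefficient at `a/b` (`|a/b| ≤ A`, `1 ≤ A`) is at most `(d+1)·4^d·H·A^d`. -/
theorem norm_taylor_coeff_le {P : ℤ[X]} {H : ℕ} (hco : ∀ k, |P.coeff k| ≤ (H : ℤ)) {d : ℕ}
    (hdeg : P.natDegree ≤ d) {a b : ℤ} {A : ℝ} (hA1 : 1 ≤ A) (hA : ‖(a : ℂ) / b‖ ≤ A) (n : ℕ) :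
    ‖(taylor ((a : ℂ) / b) (P.map (Int.castRingHom ℂ))).coeff n‖ ≤
      (d + 1) * 4 ^ d * H * A ^ d := by
  set r : ℂ := (a : ℂ) / b with hr
  have hB0 : (0 : ℝ) ≤ (d + 1) * 4 ^ d * H * A ^ d := by positivity
  rcases le_or_gt n d with hnd | hnd
  · rw [taylor_coeff, hasseDeriv_map]
    have hdegD : ((hasseDeriv n P).map (Int.castRingHom ℂ)).natDegree < d + 1 :=
      Nat.lt_succ_of_le ((natDegree_map_le).trans
        ((natDegree_hasseDeriv_le P n).trans ((Nat.sub_le _ _).trans hdeg)))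
    rw [eval_eq_sum_range' hdegD]
    refine (norm_sum_le _ _).trans ?_
    have hterm : ∀ k ∈ Finset.range (d + 1),
        ‖((hasseDeriv n P).map (Int.castRingHom ℂ)).coeff k * r ^ k‖ ≤ 4 ^ d * H * A ^ d := by
      intro k hk
      have hkd : k ≤ d := Nat.lt_succ_iff.mp (Finset.mem_range.mp hk)
      rw [norm_mul, norm_pow, coeff_map, Int.coe_castRingHom, Complex.norm_intCast]
      have h1 : |(((hasseDeriv n P).coeff k : ℤ) : ℝ)| ≤ 4 ^ d * H := by
        have := abs_coeff_hasseDeriv_le hco n k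
        have h2 : (2 : ℝ) ^ (k + n) ≤ 4 ^ d := by
          calc (2 : ℝ) ^ (k + n) ≤ 2 ^ (d + d) := pow_le_pow_right₀ one_le_two (by omega)
            _ = 4 ^ d := by rw [← two_mul, pow_mul]; norm_num
        calc |(((hasseDeriv n P).coeff k : ℤ) : ℝ)| ≤ 2 ^ (k + n) * H := by exact_mod_cast this
          _ ≤ 4 ^ d * H := by gcongr
      have h3 : ‖r‖ ^ k ≤ A ^ d :=
        (pow_le_pow_left₀ (norm_nonneg _) hA k).trans (pow_le_pow_right₀ hA1 hkd)
      exact mul_le_mul h1 h3 (by positivity) (by positivity)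
    refine (Finset.sum_le_sum hterm).trans ?_
    rw [Finset.sum_const, Finset.card_range, nsmul_eq_mul]
    push_cast
    ring_nf
    exact le_rfl
  · rw [coeff_eq_zero_of_natDegree_lt ((natDegree_taylor _ _).trans_le
      ((natDegree_map_le).trans hdeg) |>.trans_lt hnd), norm_zero]
    exact hB0

/-- Trailing-term domination: if a non-zero polynomial `T` over `ℂ` of degree `≤ d` with all
coefficients of norm `≤ B` and all NON-ZERO coefficients of norm `≥ L` vanishes at `u ≠ 0` with
`‖u‖ ≤ 1`, then `L ≤ d·B·‖u‖` (isolate the trailing coefficient). -/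
theorem trailing_domination {T : ℂ[X]} {u : ℂ} (hT0 : T ≠ 0) (hu : T.eval u = 0) (hu0 : u ≠ 0)
    (hu1 : ‖u‖ ≤ 1) {d : ℕ} (hdeg : T.natDegree ≤ d) {B L : ℝ} (hB : ∀ n, ‖T.coeff n‖ ≤ B)
    (hlow : ∀ n, T.coeff n ≠ 0 → L ≤ ‖T.coeff n‖) : L ≤ d * B * ‖u‖ := by
  set m := T.natTrailingDegree with hm
  have hdvd : X ^ m ∣ T := X_pow_dvd_iff.mpr fun k hk => coeff_eq_zero_of_lt_natTrailingDegree hk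
  obtain ⟨S, hS⟩ := hdvd
  have hScoeff : ∀ k, S.coeff k = T.coeff (k + m) := fun k => by rw [hS, coeff_X_pow_mul]
  have hS00 : S.coeff 0 ≠ 0 := by
    rw [hScoeff, zero_add]
    exact trailingCoeff_nonzero_iff_nonzero.mpr hT0
  have hS0 : S ≠ 0 := fun h => hS00 (by rw [h, coeff_zero])
  have hSeval : S.eval u = 0 := by
    have : T.eval u = u ^ m * S.eval u := by rw [hS, eval_mul, eval_pow, eval_X]
    rw [this] at hu
    exact (mul_eq_zero.mp hu).resolve_left (pow_ne_zero _ hu0)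
  have hSdeg : S.natDegree ≤ d :=
    (natDegree_le_of_dvd ⟨X ^ m, by rw [hS, mul_comm]⟩ hT0).trans hdeg
  rw [eval_eq_sum_range' (Nat.lt_succ_of_le hSdeg), Finset.sum_range_succ'] at hSeval
  simp only [pow_zero, mul_one] at hSeval
  have key : S.coeff 0 = -∑ k ∈ Finset.range d, S.coeff (k + 1) * u ^ (k + 1) := by
    linear_combination hSeval
  have hB0 : 0 ≤ B := (norm_nonneg _).trans (hB 0)
  have hup : ‖S.coeff 0‖ ≤ d * (B * ‖u‖) := by
    rw [key, norm_neg]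
    refine (norm_sum_le _ _).trans ?_
    have : ∀ k ∈ Finset.range d, ‖S.coeff (k + 1) * u ^ (k + 1)‖ ≤ B * ‖u‖ := by
      intro k _
      rw [norm_mul, norm_pow]
      have h1 : ‖S.coeff (k + 1)‖ ≤ B := by rw [hScoeff]; exact hB _
      have h2 : ‖u‖ ^ (k + 1) ≤ ‖u‖ := pow_le_of_le_one (norm_nonneg _) hu1 (Nat.succ_ne_zero k)
      exact mul_le_mul h1 h2 (by positivity) hB0
    refine (Finset.sum_le_sum this).trans ?_
    rw [Finset.sum_const, Finset.card_range, nsmul_eq_mul]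
  have hL' : L ≤ ‖S.coeff 0‖ := by
    rw [hScoeff, zero_add]
    exact hlow m (by rw [← zero_add m, ← hScoeff]; exact hS00)
  linarith

/-- **Liouville repulsion near a rational point.** If `γ ≠ a/b` is a root of a non-zero integer
polynomial of degree `≤ d` and height `≤ H`, `|a/b| ≤ A`, `1 ≤ A`, and `‖γ − a/b‖ ≤ 1`, then
`1 ≤ b^d · d · ((d+1)·4^d·H·A^d) · ‖γ − a/b‖`. Proof: Taylor-expand `P` at `a/b`; the trailing
Taylor coefficient is a non-zero rational with denominator `b^{d}` and is dominated by
`‖γ − a/b‖` times the other (bounded) coefficients. No coprimality of `a, b` is needed. -/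
theorem repulsion {P : ℤ[X]} {d H : ℕ} (hP0 : P ≠ 0) (hdeg : P.natDegree ≤ d)
    (hco : ∀ k, |P.coeff k| ≤ (H : ℤ)) {γ : ℂ} (hγ : aeval γ P = 0) {a b : ℤ} (hb : 0 < b)
    {A : ℝ} (hA1 : 1 ≤ A) (hA : ‖(a : ℂ) / b‖ ≤ A) (hne : γ ≠ (a : ℂ) / b)
    (hclose : ‖γ - (a : ℂ) / b‖ ≤ 1) :
    1 ≤ (b : ℝ) ^ d * (d * ((d + 1) * 4 ^ d * H * A ^ d)) * ‖γ - (a : ℂ) / b‖ := by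
  set r : ℂ := (a : ℂ) / b with hr
  set T : ℂ[X] := taylor r (P.map (Int.castRingHom ℂ)) with hT
  have hmap0 : P.map (Int.castRingHom ℂ) ≠ 0 := (Polynomial.map_ne_zero_iff Int.cast_injective).mpr hP0
  have hT0 : T ≠ 0 := fun h => hmap0 (taylor_injective r (by rw [← hT, h, map_zero]))
  have hTeval : T.eval (γ - r) = 0 := by
    rw [hT, taylor_eval, sub_add_cancel, eval_map, ← algebraMap_int_eq, ← aeval_def, hγ]
  have hTdeg : T.natDegree ≤ d := by
    rw [hT, natDegree_taylor]
    exact natDegree_map_le.trans hdeg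
  have hbR : (0 : ℝ) < b := by exact_mod_cast hb
  have key := trailing_domination hT0 hTeval (sub_ne_zero.mpr hne) hclose hTdeg
    (norm_taylor_coeff_le hco hdeg hA1 hA) (L := 1 / (b : ℝ) ^ d) (fun n hn => by
      rw [hT, taylor_coeff_eq_ratCast] at hn ⊢
      have hq : (eval ((a : ℚ) / b) ((hasseDeriv n P).map (algebraMap ℤ ℚ))) ≠ 0 :=
        fun h => hn (by rw [h, Rat.cast_zero])
      have h1 : (1 : ℝ) ≤ (b : ℝ) ^ d * |(((eval ((a : ℚ) / b) ((hasseDeriv n P).map (algebraMap ℤ ℚ))) : ℚ) : ℝ)| := by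
        exact_mod_cast tq_lower hb hdeg hq
      rw [Complex.norm_ratCast, div_le_iff₀ (pow_pos hbR _)]
      linarith [mul_comm ((b : ℝ) ^ d) |(((eval ((a : ℚ) / b) ((hasseDeriv n P).map (algebraMap ℤ ℚ))) : ℚ) : ℝ)|])
  have := (div_le_iff₀' (pow_pos hbR d)).mp key
  calc (1 : ℝ) ≤ (b : ℝ) ^ d * (d * ((d + 1) * 4 ^ d * H * A ^ d) * ‖γ - r‖) := this
    _ = _ := by ring

/-- `e^{n/2} ≤ 2ⁿ` (from `log 2 > 1/2`). -/
theorem two_pow_le_exp_half_inv (n : ℕ) : Real.exp ((n : ℝ) / 2) ≤ 2 ^ n := by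
  have h2 : Real.exp (1 / 2) ≤ 2 := by
    have := Real.log_two_gt_d9
    have h : (1 : ℝ) / 2 ≤ Real.log 2 := by linarith
    calc Real.exp (1 / 2) ≤ Real.exp (Real.log 2) := Real.exp_le_exp.mpr h
      _ = 2 := Real.exp_log two_pos
  calc Real.exp ((n : ℝ) / 2) = Real.exp (1 / 2) ^ n := by
        rw [← Real.exp_nat_mul]; congr 1; ring
    _ ≤ 2 ^ n := pow_le_pow_left₀ (Real.exp_pos _).le h2 n

/-- `‖a/b − ξ‖_ℂ = |ξ − a/b|` for real `ξ`. -/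
theorem norm_ratpt_sub_real (a b : ℤ) (ξ : ℝ) : ‖(a : ℂ) / b - (ξ : ℂ)‖ = |ξ - a / b| := by
  have : ((a : ℂ) / b - (ξ : ℂ)) = (((a : ℝ) / b - ξ : ℝ) : ℂ) := by push_cast; ring
  rw [this, Complex.norm_real, Real.norm_eq_abs, abs_sub_comm]

/-- **The scale-exponent (output-independent) form of the `t = 1` approximation property is false
at every Liouville number, for every constant `c ≥ 1`.** The negated statement is the body of
`ApproximationPropertyDegOne` at `θ = (ξ)` with the target `exp(−(log H·Δ + d·Y)/c)` replaced by
`exp(−ΔY/c)`. Witness scale: `Δ = 4c²`, `Y = log(1/η)/(2c)` where `|ξ − a/b| = η < b⁻ⁿ`,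
`n = 2⌊4c³⌋ + m₀ + n₁` (`2^{m₀} > 4K²`, `n₁ ≥ 16c³`): then `a/b` is only `η > η²`-accurate and
every other certified `γ` is repelled by `repulsion`. [cite: LaurentRoy1999, pp. 27–28] -/
theorem scaleExponent_false_at_liouville {ξ : ℝ} (hξ : Liouville ξ) {c : ℝ} (hc : 1 ≤ c) :
    ¬ (∀ Δ Y : ℝ, c ≤ Δ → Δ ≤ Y → ∃ (γ : Fin 1 → ℂ) (d H : ℕ),
      Module.finrank ℚ ↥(IntermediateField.adjoin ℚ (Set.range γ)) ≤ d ∧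
      (∀ i, ∃ P : Polynomial ℤ, P ≠ 0 ∧ P.natDegree ≤ d ∧ (∀ k, |P.coeff k| ≤ (H : ℤ)) ∧
        Polynomial.aeval (γ i) P = 0) ∧
      (d : ℝ) ≤ c * Δ ∧ Real.log H ≤ c * Y ∧ ‖γ - (fun _ : Fin 1 => (ξ : ℂ))‖ ≤ Real.exp (-(Δ * Y / c))) := by
  intro h
  have hc0 : 0 < c := by linarith
  have hc3 : (1 : ℝ) ≤ c ^ 3 := one_le_pow₀ hc
  -- constants depending on `c` and `ξ` only
  set D : ℕ := ⌊c * (4 * c ^ 2)⌋₊ with hD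
  set A : ℝ := |ξ| + 2 with hA
  have hA1 : 1 ≤ A := by rw [hA]; linarith [abs_nonneg ξ]
  set K : ℝ := D * ((D + 1) * 4 ^ D * A ^ D) with hK
  have hK0 : 0 ≤ K := by positivity
  obtain ⟨m₀, hm₀⟩ := pow_unbounded_of_one_lt (4 * K ^ 2) (one_lt_two (α := ℝ))
  obtain ⟨n₁, hn₁⟩ := exists_nat_ge (16 * c ^ 3)
  -- the Liouville approximation at exponent `n`
  set n : ℕ := 2 * D + m₀ + n₁ with hn
  have hn₁n : (n₁ : ℝ) ≤ n := by exact_mod_cast (show n₁ ≤ n by omega)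
  have h16n : 16 * c ^ 3 ≤ n := hn₁.trans hn₁n
  obtain ⟨a, b, hb1, hne, hlt⟩ := hξ n
  have hb0 : (0 : ℤ) < b := by linarith
  have hbR : (2 : ℝ) ≤ b := by exact_mod_cast (show (2 : ℤ) ≤ b by linarith)
  have hbR0 : (0 : ℝ) < b := by linarith
  have hb1R : (1 : ℝ) ≤ b := by linarith
  set η : ℝ := |ξ - a / b| with hη
  have hη0 : 0 < η := abs_pos.mpr (sub_ne_zero.mpr hne)
  have hbn : (2 : ℝ) ^ n ≤ (b : ℝ) ^ n := pow_le_pow_left₀ zero_le_two hbR n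
  have hηbn : η * (b : ℝ) ^ n < 1 := by
    have := hlt; rw [lt_div_iff₀ (pow_pos hbR0 n)] at this; simpa [hη] using this
  have hn1 : 1 ≤ n := by
    have : (1 : ℝ) ≤ n := by linarith
    exact_mod_cast this
  have hη_half : η < 1 / 2 := by
    have h2n : (2 : ℝ) ≤ 2 ^ n := by
      calc (2 : ℝ) = 2 ^ 1 := (pow_one _).symm
        _ ≤ 2 ^ n := pow_le_pow_right₀ one_le_two hn1
    have : η * 2 ≤ η * (b : ℝ) ^ n := mul_le_mul_of_nonneg_left (h2n.trans hbn) hη0.le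
    rw [lt_div_iff₀ two_pos]
    linarith
  have hη1 : η < 1 := by linarith
  have hη2 : η ^ 2 < η := by
    rw [sq]; simpa using mul_lt_mul_of_pos_right hη1 hη0
  -- the logarithmic size of `1/η`
  have hlog : (n : ℝ) / 2 ≤ Real.log (1 / η) := by
    have h1 : Real.exp ((n : ℝ) / 2) ≤ 1 / η := by
      rw [le_div_iff₀ hη0]
      calc Real.exp ((n : ℝ) / 2) * η ≤ 2 ^ n * η :=
            mul_le_mul_of_nonneg_right (two_pow_le_exp_half_inv n) hη0.le
        _ ≤ (b : ℝ) ^ n * η := mul_le_mul_of_nonneg_right hbn hη0.le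
        _ ≤ 1 := by linarith [mul_comm η ((b : ℝ) ^ n)]
    have := Real.log_le_log (Real.exp_pos _) h1
    rwa [Real.log_exp] at this
  -- the scale
  set Δ : ℝ := 4 * c ^ 2 with hΔ
  set Y : ℝ := Real.log (1 / η) / (2 * c) with hY
  have hcΔ : c ≤ Δ := by
    have h1 : c ≤ c ^ 2 := by rw [sq]; exact le_mul_of_one_le_right hc0.le hc
    rw [hΔ]; nlinarith [sq_nonneg c]
  have hΔY : Δ ≤ Y := by
    rw [hY, le_div_iff₀ (by linarith), hΔ]
    have : 4 * c ^ 2 * (2 * c) = 16 * c ^ 3 / 2 := by ring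
    rw [this]
    linarith
  obtain ⟨γ, d, H, -, hcert, hd, hH, hdist⟩ := h Δ Y hcΔ hΔY
  obtain ⟨P, hP0, hPdeg, hPco, hPγ⟩ := hcert 0
  -- the required accuracy is `η²`
  have hexp : Real.exp (-(Δ * Y / c)) = η ^ 2 := by
    have : -(Δ * Y / c) = (2 : ℕ) * Real.log η := by
      rw [hΔ, hY, one_div, Real.log_inv]; field_simp; ring
    rw [this, Real.exp_nat_mul, Real.exp_log hη0]
  have hγ : ‖γ 0 - ξ‖ ≤ η ^ 2 := by
    have := norm_le_pi_norm (γ - fun _ : Fin 1 => (ξ : ℂ)) 0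
    simp only [Pi.sub_apply] at this
    exact this.trans (hdist.trans_eq hexp)
  -- the height budget: `H² · η ≤ 1`
  have hH2 : (H : ℝ) ^ 2 * η ≤ 1 := by
    rcases Nat.eq_zero_or_pos H with h0 | hpos
    · simp [h0]
    · have hHR : (0 : ℝ) < H := by exact_mod_cast hpos
      have hcY : c * Y = Real.log (1 / η) / 2 := by rw [hY]; field_simp
      have h1 : Real.log ((H : ℝ) ^ 2) ≤ Real.log (1 / η) := by
        rw [Real.log_pow]; push_cast; linarith [hcY ▸ hH]
      have h2 := (Real.log_le_log_iff (by positivity) (by positivity)).mp h1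
      rwa [le_div_iff₀ hη0] at h2
  have hnorm : ‖(a : ℂ) / b - (ξ : ℂ)‖ = η := by rw [norm_ratpt_sub_real]
  by_cases hγr : γ 0 = (a : ℂ) / b
  · -- the rational approximation itself is not accurate enough: `η ≤ η²`
    rw [hγr, hnorm] at hγ
    linarith
  · set δ : ℝ := ‖γ 0 - (a : ℂ) / b‖ with hδ
    have htri : δ - η ≤ ‖γ 0 - ξ‖ := by
      have := norm_sub_le_norm_sub_add_norm_sub (γ 0) (ξ : ℂ) ((a : ℂ) / b)
      rw [norm_sub_rev (ξ : ℂ), hnorm] at this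
      linarith
    by_cases hfar : δ ≤ 1
    · have hAab : ‖(a : ℂ) / b‖ ≤ A := by
        have := norm_le_norm_add_norm_sub' ((a : ℂ) / b) (ξ : ℂ)
        rw [Complex.norm_real, Real.norm_eq_abs, hnorm] at this
        rw [hA]; linarith
      have rep := repulsion hP0 hPdeg hPco hPγ hb0 hA1 hAab hγr hfar
      -- monotone in `d ≤ D`
      have hdD : d ≤ D := by rw [hD]; exact Nat.le_floor hd
      have hmono : (b : ℝ) ^ d * (d * ((d + 1) * 4 ^ d * H * A ^ d)) ≤
          (b : ℝ) ^ D * (K * H) := by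
        have h1 : (b : ℝ) ^ d ≤ (b : ℝ) ^ D := pow_le_pow_right₀ hb1R hdD
        have hdD' : (d : ℝ) ≤ D := by exact_mod_cast hdD
        have h4 : (4 : ℝ) ^ d ≤ 4 ^ D := pow_le_pow_right₀ (by norm_num) hdD
        have h5 : A ^ d ≤ A ^ D := pow_le_pow_right₀ hA1 hdD
        have h2 : (d : ℝ) * ((d + 1) * 4 ^ d * H * A ^ d) ≤ D * ((D + 1) * 4 ^ D * H * A ^ D) := by
          apply mul_le_mul hdD' _ (by positivity) (by positivity)
          apply mul_le_mul _ h5 (by positivity) (by positivity)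
          apply mul_le_mul_of_nonneg_right _ (by positivity)
          exact mul_le_mul (by linarith) h4 (by positivity) (by positivity)
        calc (b : ℝ) ^ d * (d * ((d + 1) * 4 ^ d * H * A ^ d))
            ≤ (b : ℝ) ^ D * (D * ((D + 1) * 4 ^ D * H * A ^ D)) :=
              mul_le_mul h1 h2 (by positivity) (by positivity)
          _ = (b : ℝ) ^ D * (K * H) := by rw [hK]; ring
      have rep' : 1 ≤ (b : ℝ) ^ D * (K * H) * δ :=
        rep.trans (mul_le_mul_of_nonneg_right hmono (norm_nonneg _))
      -- hence `δ ≥ 2η`, for otherwise: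
      have hδη : 2 * η ≤ δ := by
        by_contra hlt2
        push Not at hlt2
        have h1 : 1 ≤ (b : ℝ) ^ D * (K * H) * (2 * η) :=
          rep'.trans (mul_le_mul_of_nonneg_left hlt2.le (by positivity))
        have h2 : (1 : ℝ) ≤ ((b : ℝ) ^ D * (K * H) * (2 * η)) ^ 2 := one_le_pow₀ h1
        have h3 : ((b : ℝ) ^ D * (K * H) * (2 * η)) ^ 2 ≤ 4 * K ^ 2 * (b : ℝ) ^ (2 * D) * η := by
          have : ((b : ℝ) ^ D * (K * H) * (2 * η)) ^ 2
              = 4 * K ^ 2 * (b : ℝ) ^ (2 * D) * η * ((H : ℝ) ^ 2 * η) := by ring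
          rw [this]
          exact mul_le_of_le_one_right (by positivity) hH2
        have h4 : 4 * K ^ 2 * (b : ℝ) ^ (2 * D) * η < 1 := by
          have hbpow : (b : ℝ) ^ n = (b : ℝ) ^ (2 * D) * (b : ℝ) ^ (m₀ + n₁) := by
            rw [← pow_add]; congr 1; omega
          have hm : 4 * K ^ 2 ≤ (b : ℝ) ^ (m₀ + n₁) := by
            calc 4 * K ^ 2 ≤ 2 ^ m₀ := hm₀.le
              _ ≤ (b : ℝ) ^ m₀ := pow_le_pow_left₀ zero_le_two hbR m₀
              _ ≤ (b : ℝ) ^ (m₀ + n₁) := pow_le_pow_right₀ hb1R (Nat.le_add_right _ _)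
          rw [hbpow] at hηbn
          calc 4 * K ^ 2 * (b : ℝ) ^ (2 * D) * η = 4 * K ^ 2 * ((b : ℝ) ^ (2 * D) * η) := by ring
            _ ≤ (b : ℝ) ^ (m₀ + n₁) * ((b : ℝ) ^ (2 * D) * η) :=
                mul_le_mul_of_nonneg_right hm (by positivity)
            _ = η * ((b : ℝ) ^ (2 * D) * (b : ℝ) ^ (m₀ + n₁)) := by ring
            _ < 1 := hηbn
        linarith
      -- and then `‖γ 0 - ξ‖ ≥ δ - η ≥ η > η²`
      linarith
    · push Not at hfar
      -- `‖γ 0 - ξ‖ ≥ δ - η > 1 - 1/2 > η²`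
      linarith

/-- A one-element tuple generates a field of transcendence degree `≤ 1`. -/
theorem trdeg_adjoin_range_fin_one_le (θ : Fin 1 → ℂ) :
    Algebra.trdeg ℚ ↥(IntermediateField.adjoin ℚ (Set.range θ)) ≤ 1 := by
  have h := Literature.NumberTheory.Transcendental.Philippon1986_criterion.trdeg_adjoin_range_le
    (F := ℚ) (E := ℂ) θ
  rw [Nat.cast_one] at h
  convert h using 2
  · rfl
  · exact Subsingleton.elim _ _

/-- **The scale-exponent form of the `t = 1` approximation property is false** (quantified over
all finite tuples of transcendence degree `≤ 1`, exactly as `ApproximationPropertyDegOne` but with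
the output-independent accuracy `exp(−ΔY/c)`): witness Liouville's constant `Σ 2^{-k!}` as a
one-element tuple. [cite: LaurentRoy1999, pp. 27–28 (remark after the introduction's first display)] -/
theorem scaleExponent_false :
    ¬ (∀ (ι : Type) [Fintype ι] (θ : ι → ℂ),
        Algebra.trdeg ℚ ↥(IntermediateField.adjoin ℚ (Set.range θ)) ≤ 1 →
        ∃ c : ℝ, 1 ≤ c ∧ ∀ Δ Y : ℝ, c ≤ Δ → Δ ≤ Y → ∃ (γ : ι → ℂ) (d H : ℕ),
          Module.finrank ℚ ↥(IntermediateField.adjoin ℚ (Set.range γ)) ≤ d ∧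
          (∀ i, ∃ P : Polynomial ℤ, P ≠ 0 ∧ P.natDegree ≤ d ∧ (∀ k, |P.coeff k| ≤ (H : ℤ)) ∧
            Polynomial.aeval (γ i) P = 0) ∧
          (d : ℝ) ≤ c * Δ ∧ Real.log H ≤ c * Y ∧ ‖γ - θ‖ ≤ Real.exp (-(Δ * Y / c))) := by
  intro h
  obtain ⟨c, hc, hall⟩ := h (Fin 1) (fun _ => ((liouvilleNumber 2 : ℝ) : ℂ))
    (trdeg_adjoin_range_fin_one_le _)
  exact scaleExponent_false_at_liouville (liouville_liouvilleNumber le_rfl) hc hall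

end Summit.Schanuel.Schanuel.Theorems.ApproximationPropertyScaleExponentLiouville

end
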